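import Summits.Ventures.HodgeRepro2.T5FinitePlaceLiesOver

/-!
# The local degree of a quadratic extension at a finite place: `[E_w : F_v] = 1 ⟺ θ is a square in F_v`
(cell pub-hodge-repro2, seat p3)

Tier-5 N2 support, §N2.9.2 of route/T5-N2-route-3.md («completions») at the finite places, continued from
T5FinitePlaceLiesOver (file 115). For number fields `F ⊆ E` with `E = F(s)`, `s² = θ ∈ F` (`span_F {1, s} = ⊤` —
the CM field `F = F⁺(√θ)` of route/T4-B1-p3.md l. 22 and file 103), a finite place `v` of `F` and `w ∣ v` of `E`:

* `finrank_eq_one_iff_isSquare : finrank F_v E_w = 1 ↔ IsSquare (algebraMap F F_v θ)` — the place `w` is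
  «split over `v`» (`E_w = F_v`) exactly when `θ` is a `v`-adic square; `bijective_completionMap_iff_isSquare`;
* `finrank_le_two`, `finrank_eq_one_or_two`, `finrank_eq_two_iff_not_isSquare` — the local degree is `1` or `2`.

This is the LOCAL half of «`d` is a square in `F_v` ⟺ `v` splits in `E`» (HANDOFF-p3.md g57) at ONE place `w`;
the number of places `w ∣ v` (the global count `Σ_w [E_w : F_v] = 2`) is not here. Mathlib + file 115 only.
No display; no device. §8(d): uses an L-value-free non-vanishing device: NO.
-/

namespace Summit.Ventures.HodgeRepro2.T5FinitePlaceQuadratic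

open IsDedekindDomain IsDedekindDomain.HeightOneSpectrum NumberField Module
open scoped Summit.Ventures.HodgeRepro2.T5FinitePlaceLiesOver
open Summit.Ventures.HodgeRepro2.T5FinitePlaceLiesOver

variable {F E : Type*} [Field F] [NumberField F] [Field E] [NumberField E] [Algebra F E]
variable (v : HeightOneSpectrum (𝓞 F)) (w : HeightOneSpectrum (𝓞 E)) [w.asIdeal.LiesOver v.asIdeal]
variable {s : E} {θ : F}

/-- The image of `s` in `E_w` squares to the image of `θ` through `F_v`. -/
theorem algebraMap_sq_eq (hs : s ^ 2 = algebraMap F E θ) :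
    (algebraMap E (w.adicCompletion E) s) ^ 2 =
      algebraMap (v.adicCompletion F) (w.adicCompletion E) (algebraMap F (v.adicCompletion F) θ) := by
  rw [← map_pow, hs, ← IsScalarTower.algebraMap_apply F E (w.adicCompletion E),
    ← IsScalarTower.algebraMap_apply F (v.adicCompletion F) (w.adicCompletion E)]

/-- If `[E_w : F_v] = 1` then `θ` is a square in `F_v`. -/
theorem isSquare_of_finrank_eq_one (hs : s ^ 2 = algebraMap F E θ)
    (h : finrank (v.adicCompletion F) (w.adicCompletion E) = 1) :
    IsSquare (algebraMap F (v.adicCompletion F) θ) := by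
  obtain ⟨hinj, hsurj⟩ := Algebra.finrank_eq_one_iff_bijective_algebraMap.mp h
  obtain ⟨c, hc⟩ := hsurj (algebraMap E (w.adicCompletion E) s)
  refine ⟨c, hinj ?_⟩
  rw [map_mul, hc, ← sq, algebraMap_sq_eq v w hs]

/-- If `θ` is a square in `F_v` then `[E_w : F_v] = 1`: `(S − T)(S + T) = 0` in the field `E_w` forces
`S = ±T ∈ F_v`, so `E_w = F_v · E = F_v · (F + F s) = F_v` (`tensorLift_surjective`). -/
theorem finrank_eq_one_of_isSquare (hs : s ^ 2 = algebraMap F E θ)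
    (hspan : Submodule.span F {(1 : E), s} = ⊤) (hsq : IsSquare (algebraMap F (v.adicCompletion F) θ)) :
    finrank (v.adicCompletion F) (w.adicCompletion E) = 1 := by
  obtain ⟨t, ht⟩ := hsq
  set S := algebraMap E (w.adicCompletion E) s with hS
  set T := algebraMap (v.adicCompletion F) (w.adicCompletion E) t with hT
  have hST : S = T ∨ S = -T := by
    have h0 : (S + T) * (S - T) = 0 := by
      rw [← sq_sub_sq, hS, hT, algebraMap_sq_eq v w hs, ht, map_mul, sq, sub_self]
    rcases mul_eq_zero.mp h0 with h | h
    · exact Or.inr (add_eq_zero_iff_eq_neg.mp h)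
    · exact Or.inl (sub_eq_zero.mp h)
  have hSmem : S ∈ (algebraMap (v.adicCompletion F) (w.adicCompletion E)).range := by
    rcases hST with h | h
    · exact ⟨t, h.symm⟩
    · exact ⟨-t, by rw [map_neg, h]⟩
  refine Algebra.finrank_eq_one_iff_bijective_algebraMap.mpr
    ⟨(algebraMap (v.adicCompletion F) (w.adicCompletion E)).injective, fun y => ?_⟩
  obtain ⟨z, rfl⟩ := tensorLift_surjective v w y
  suffices hz : ∀ z, tensorLift v w z ∈ (algebraMap (v.adicCompletion F) (w.adicCompletion E)).range from
    hz z
  intro z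
  induction z using TensorProduct.induction_on with
  | zero => exact ⟨0, by simp⟩
  | add x y hx hy => rw [map_add]; exact Subring.add_mem _ hx hy
  | tmul a e =>
    rw [tensorLift_tmul]
    refine Subring.mul_mem _ ⟨a, rfl⟩ ?_
    have he : e ∈ Submodule.span F {(1 : E), s} := hspan ▸ Submodule.mem_top
    obtain ⟨c, d, rfl⟩ := Submodule.mem_span_pair.mp he
    rw [map_add, Algebra.smul_def, Algebra.smul_def, map_mul, map_mul, map_one, mul_one,
      ← IsScalarTower.algebraMap_apply F E (w.adicCompletion E) c,
      ← IsScalarTower.algebraMap_apply F E (w.adicCompletion E) d,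
      IsScalarTower.algebraMap_apply F (v.adicCompletion F) (w.adicCompletion E) c,
      IsScalarTower.algebraMap_apply F (v.adicCompletion F) (w.adicCompletion E) d]
    exact Subring.add_mem _ ⟨_, rfl⟩ (Subring.mul_mem _ ⟨_, rfl⟩ hSmem)

/-- **`[E_w : F_v] = 1 ⟺ θ is a square in `F_v`.** -/
theorem finrank_eq_one_iff_isSquare (hs : s ^ 2 = algebraMap F E θ)
    (hspan : Submodule.span F {(1 : E), s} = ⊤) :
    finrank (v.adicCompletion F) (w.adicCompletion E) = 1 ↔
      IsSquare (algebraMap F (v.adicCompletion F) θ) :=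
  ⟨isSquare_of_finrank_eq_one v w hs, finrank_eq_one_of_isSquare v w hs hspan⟩

/-- `completionMap : F_v → E_w` is an isomorphism exactly when `θ` is a `v`-adic square. -/
theorem bijective_completionMap_iff_isSquare (hs : s ^ 2 = algebraMap F E θ)
    (hspan : Submodule.span F {(1 : E), s} = ⊤) :
    Function.Bijective (completionMap F E v w) ↔ IsSquare (algebraMap F (v.adicCompletion F) θ) := by
  rw [← finrank_eq_one_iff_isSquare v w hs hspan, Algebra.finrank_eq_one_iff_bijective_algebraMap]
  rfl

omit [NumberField F] [NumberField E] in
/-- `[E : F] ≤ 2` when `E = F + F s`. -/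
theorem finrank_le_two_of_span (hspan : Submodule.span F {(1 : E), s} = ⊤) : finrank F E ≤ 2 := by
  classical
  have h := finrank_span_le_card (R := F) ({(1 : E), s} : Set E)
  rw [hspan, finrank_top] at h
  refine h.trans ?_
  rw [Set.toFinset_insert, Set.toFinset_singleton]
  exact Finset.card_le_two

/-- `[E_w : F_v] ≤ 2`. -/
theorem finrank_le_two (hspan : Submodule.span F {(1 : E), s} = ⊤) :
    finrank (v.adicCompletion F) (w.adicCompletion E) ≤ 2 :=
  (finrank_le v w).trans (finrank_le_two_of_span hspan)

/-- `[E_w : F_v] ∈ {1, 2}`. -/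
theorem finrank_eq_one_or_two (hspan : Submodule.span F {(1 : E), s} = ⊤) :
    finrank (v.adicCompletion F) (w.adicCompletion E) = 1 ∨
      finrank (v.adicCompletion F) (w.adicCompletion E) = 2 := by
  have h1 := finrank_pos v w
  have h2 := finrank_le_two v w hspan
  omega

/-- **`[E_w : F_v] = 2 ⟺ θ is NOT a square in `F_v`.** -/
theorem finrank_eq_two_iff_not_isSquare (hs : s ^ 2 = algebraMap F E θ)
    (hspan : Submodule.span F {(1 : E), s} = ⊤) :
    finrank (v.adicCompletion F) (w.adicCompletion E) = 2 ↔
      ¬ IsSquare (algebraMap F (v.adicCompletion F) θ) := by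
  rw [← finrank_eq_one_iff_isSquare v w hs hspan]
  rcases finrank_eq_one_or_two v w hspan with h | h <;> rw [h] <;> omega

end Summit.Ventures.HodgeRepro2.T5FinitePlaceQuadratic
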